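import Summits.KontsevichZagierPeriods.KontsevichZagierPeriods.Theses.PhiFourHepp
import Literature.NumberTheory.Transcendental.KZKernelConjectureForms

/-!
# `KernelOfSummitR` (stmt-KontsevichZagierPeriods-13814, route PhiFourHepp) — proof

Honest-status lemma of route PhiFourHepp: the summit `KontsevichZagierPeriods` itself implies the
route's kernel target `PhiFourKernelH` (every formal `ℤ`-combination of integral representations
with value `0` lies in the subgroup generated by the four moves together with the Hepp relator
scheme). Pure logic over route declarations: the summit is the KZ-literal two-representation form
of Conjecture 1 (`KontsevichZagierPeriods_iff`), which is equivalent to the kernel form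
`ker KZ.eval = KZ.relations` (`Literature.NumberTheory.Transcendental.kzKernelConjecture_iff_isRational`,
proved in tree), and `KZ.relations = AddSubgroup.closure (moves)` sits inside
`AddSubgroup.closure (moves ∪ Hepp relators)` by monotonicity of `AddSubgroup.closure`.
Planner-proved glue (Sketch2.lean of the route-repair planner, re-checked by refuter g47-0),
landed by lead c10 of crux stmt-KontsevichZagierPeriods-9129 (banking). No definitions.
-/

namespace Summit.KontsevichZagierPeriods.PhiFourHepp

open Summit.KontsevichZagierPeriods.KontsevichZagierPeriods.Theses.PhiFourHepp

/-- **`KernelOfSummitR`** (route PhiFourHepp, stmt-KontsevichZagierPeriods-13814): the summit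
`KontsevichZagierPeriods` implies `PhiFourKernelH`, i.e. if Conjecture 1 holds for KZ-rational
representations then every formal combination `c` with `KZ.eval c = 0` lies in the subgroup
generated by the four moves and the Hepp relators. Proof: the summit unfolds
(`KontsevichZagierPeriods_iff`) to the right-hand side of
`kzKernelConjecture_iff_isRational`, giving `c ∈ KZ.relations = closure (moves)`, and
`closure (moves) ≤ closure (moves ∪ HeppRelators)` by `AddSubgroup.closure_mono
Set.subset_union_left`. [folklore] -/
theorem kernelOfSummitR_proof :
    Summit.KontsevichZagierPeriods.KontsevichZagierPeriods.Theses.PhiFourHepp.KernelOfSummitR := by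
  intro h c hc
  have hK : Literature.NumberTheory.Transcendental.KZKernelConjecture :=
    Literature.NumberTheory.Transcendental.kzKernelConjecture_iff_isRational.mpr
      (KontsevichZagierPeriods_iff.mp h)
  exact AddSubgroup.closure_mono Set.subset_union_left (hK c hc)

end Summit.KontsevichZagierPeriods.PhiFourHepp
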